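import Mathlib
import Literature.NumberTheory.Transcendental.KZCalculusProofs
import Literature.NumberTheory.Transcendental.SemialgebraicMapsProofs
import Literature.NumberTheory.Transcendental.KZSemialgebraicComplex

/-!
# Crux `VolumeFormOffPlane` (stmt-KontsevichZagierPeriods-14935) — line `Sketch`,
stub `stub_inversionMove` (the two INVERSION moves)

Coordinates on `ℝ³`: `x = p 0`, `y = p 1`, slack `z = p 2`. For `A > 0` real algebraic the maps

* `R_A (x, y, z) = (A / x, y, z · x² / A)` on `{x > 0}`,
* `S_A (x, y, z) = (x, A / y, z · y² / A)` on `{y > 0}`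

(in logarithmic coordinates `u = log x` the reflection `u ↦ log A − u`, the slack being rescaled
so that `z · x · y` is preserved) are each ONE change-of-variables generator of the
Kontsevich–Zagier calculus (`KZ.changeOfVariablesRel`, rule (2) of [Kontsevich–Zagier 2001,
§1.2]). Checked against the five fields of the generator:

* `R_A` is a `ℚ`-semialgebraic map on every `ℚ`-semialgebraic `σ ⊆ {x > 0}` (coordinates: the
  algebraic constant `A` divided by the coordinate `x`; the coordinate `y`; the polynomial `z x²`
  divided by the algebraic constant `A`);
* `R_A` has at `p` (`x ≠ 0`) the Fréchet derivative of (lower triangular) matrix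
  `!![-A / x², 0, 0; 0, 1, 0; 2 z x / A, 0, x² / A]`, of determinant `-1`;
* `R_A` is an involution of `{x > 0}`, hence injective there, and it carries `σ ⊆ {x > 0}` onto
  any `σ' ⊆ {x > 0}` to which membership is transported (`p ∈ σ ↔ R_A p ∈ σ'` on `{x > 0}`);
* `1 = 1 · |−1|` for integrand-`1` representations.

So `[r] − [r'] ∈ KZ.changeOfVariablesRel ⊆ KZ.relations`; likewise for `S_A` (coordinates `0`
and `1` exchanged). The generic step "an involution with `|det| = 1` transporting membership is
one rule-(2) move" is `inv_mem_relations_of_involutive` (any dimension).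

Sources: M. Kontsevich, D. Zagier, *Periods* (2001), §1.2 rule (2); the rest is calculus
bookkeeping (folklore). Models: `Theorems/SymplecticScissorsVolumeFormPerspectiveMap.lean`,
`Theorems/HyperbolicBlochIsometryMoveInversion.lean`.
-/

noncomputable section

open MeasureTheory Set MvPolynomial
open Literature.NumberTheory.Transcendental Literature.ModelTheory.ExponentialFields

namespace Summit.KontsevichZagierPeriods.SymplecticScissors.LogPolytope

/-! ## An involution with `|det| = 1` is one rule-(2) move -/

/-- **Rule (2) for involutions.** Let `U ⊆ ℝⁿ` and let `Φ : ℝⁿ → ℝⁿ` be `ℚ`-semialgebraic on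
every `ℚ`-semialgebraic subset of `U`, differentiable at every point of `U` with a derivative of
determinant `±1`, mapping `U` into `U` with `Φ (Φ p) = p` there. If `r`, `r'` are integrand-`1`
representations with domains inside `U` and `p ∈ r.domain ↔ Φ p ∈ r'.domain` on `U`, then
`r'.domain = Φ '' r.domain`, `Φ` is injective on `r.domain`, and `[r] − [r']` is the
change-of-variables generator `⟨n, r, r', Φ, Φ', …⟩` of the KZ calculus, hence a relation.
[Kontsevich–Zagier 2001, §1.2, rule (2)] [folklore] -/
theorem inv_mem_relations_of_involutive {n : ℕ} {U : Set (Fin n → ℝ)}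
    {Φ : (Fin n → ℝ) → (Fin n → ℝ)}
    (hsa : ∀ s : Set (Fin n → ℝ), s ⊆ U → IsSemialgebraic ℚ s → IsSemialgebraicMapOn ℚ s Φ)
    (hder : ∀ p ∈ U, ∃ L : (Fin n → ℝ) →L[ℝ] (Fin n → ℝ), HasFDerivAt Φ L p ∧ |L.det| = 1)
    (hmaps : ∀ p ∈ U, Φ p ∈ U) (hinv : ∀ p ∈ U, Φ (Φ p) = p)
    (r r' : KZ.IntegralRep n) (hr : r.domain ⊆ U) (hr' : r'.domain ⊆ U)
    (htr : ∀ p ∈ U, p ∈ r.domain ↔ Φ p ∈ r'.domain)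
    (h1 : ∀ p ∈ r.domain, r.integrand p = 1) (h1' : ∀ p ∈ r'.domain, r'.integrand p = 1) :
    KZ.of r - KZ.of r' ∈ KZ.relations := by
  -- a derivative at every point of `U` (chosen arbitrarily elsewhere)
  have hex : ∀ p : Fin n → ℝ, ∃ L : (Fin n → ℝ) →L[ℝ] (Fin n → ℝ),
      p ∈ U → HasFDerivAt Φ L p ∧ |L.det| = 1 := fun p => by
    by_cases hp : p ∈ U
    · obtain ⟨L, hL⟩ := hder p hp
      exact ⟨L, fun _ => hL⟩
    · exact ⟨0, fun h => (hp h).elim⟩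
  choose Φ' hΦ' using hex
  refine KZ.changeOfVariablesRel_subset_relations
    ⟨n, r, r', Φ, Φ', hsa _ hr r.isSemialgebraic_domain,
      fun x hx => ((hΦ' x (hr hx)).1).hasFDerivWithinAt, ?_, ?_, ?_, rfl⟩
  · -- injectivity: `Φ` is an involution on `U ⊇ r.domain`
    intro p hp q hq hpq
    rw [← hinv p (hr hp), ← hinv q (hr hq), hpq]
  · -- the image: `r'.domain = Φ '' r.domain`
    refine Subset.antisymm (fun q hq => ?_) ?_
    · have hqU : q ∈ U := hr' hq
      refine ⟨Φ q, (htr _ (hmaps q hqU)).2 ?_, hinv q hqU⟩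
      rw [hinv q hqU]
      exact hq
    · rintro _ ⟨p, hp, rfl⟩
      exact (htr p (hr hp)).1 hp
  · -- the integrands: `1 = 1 · |det|`
    intro x hx
    rw [h1 x hx, h1' _ ((htr x (hr hx)).1 hx), (hΦ' x (hr hx)).2, mul_one]

/-! ## Calculus of the two inversions -/

/-- The derivative of `x ↦ A / x a` at `p` (`p a ≠ 0`): `v ↦ A · (−(p a)⁻² · v a)`. [folklore] -/
theorem inv_hasFDerivAt_constDiv (A : ℝ) (a : Fin 3) (p : Fin 3 → ℝ) (hp : p a ≠ 0) :
    HasFDerivAt (fun x : Fin 3 → ℝ => A / x a)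
      (A • ((-(p a ^ 2)⁻¹) • ContinuousLinearMap.proj (R := ℝ) (φ := fun _ : Fin 3 => ℝ) a)) p := by
  have h : HasFDerivAt (fun x : Fin 3 → ℝ => A * (x a)⁻¹)
      (A • ((-(p a ^ 2)⁻¹) • ContinuousLinearMap.proj (R := ℝ) (φ := fun _ : Fin 3 => ℝ) a)) p :=
    ((hasDerivAt_inv hp).comp_hasFDerivAt p (hasFDerivAt_apply a p)).const_mul A
  simpa only [div_eq_mul_inv] using h

/-- The derivative of `x ↦ x 2 · (x a)² / A` at `p`:
`v ↦ (p 2 · (2 (p a) · v a) + (p a)² · v 2) · A⁻¹`. [folklore] -/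
theorem inv_hasFDerivAt_mulSqDiv (A : ℝ) (a : Fin 3) (p : Fin 3 → ℝ) :
    HasFDerivAt (fun x : Fin 3 → ℝ => x 2 * x a ^ 2 / A)
      (A⁻¹ • (p 2 • (((2 : ℕ) • p a ^ (2 - 1)) •
          ContinuousLinearMap.proj (R := ℝ) (φ := fun _ : Fin 3 => ℝ) a) +
        p a ^ 2 • ContinuousLinearMap.proj (R := ℝ) (φ := fun _ : Fin 3 => ℝ) 2)) p := by
  have h : HasFDerivAt (fun x : Fin 3 → ℝ => x 2 * x a ^ 2 * A⁻¹)
      (A⁻¹ • (p 2 • (((2 : ℕ) • p a ^ (2 - 1)) •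
          ContinuousLinearMap.proj (R := ℝ) (φ := fun _ : Fin 3 => ℝ) a) +
        p a ^ 2 • ContinuousLinearMap.proj (R := ℝ) (φ := fun _ : Fin 3 => ℝ) 2)) p :=
    ((hasFDerivAt_apply 2 p).fun_mul ((hasFDerivAt_apply a p).pow 2)).mul_const A⁻¹
  simpa only [div_eq_mul_inv] using h

/-- **Derivative and Jacobian of `R_A`.** At `p` with `x = p 0 ≠ 0` the map
`R_A (x, y, z) = (A / x, y, z x² / A)` has the Fréchet derivative of matrix
`!![-A / x², 0, 0; 0, 1, 0; 2 z x / A, 0, x² / A]`, whose determinant is `−1`. [folklore] -/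
theorem inv_hasFDerivAt_det_fst {A : ℝ} (hA : A ≠ 0) {p : Fin 3 → ℝ} (hp : p 0 ≠ 0) :
    ∃ L : (Fin 3 → ℝ) →L[ℝ] (Fin 3 → ℝ),
      HasFDerivAt (fun x : Fin 3 → ℝ => (![A / x 0, x 1, x 2 * x 0 ^ 2 / A] : Fin 3 → ℝ)) L p ∧
        |L.det| = 1 := by
  set M : Matrix (Fin 3) (Fin 3) ℝ :=
    !![-A / p 0 ^ 2, 0, 0; 0, 1, 0; 2 * p 2 * p 0 / A, 0, p 0 ^ 2 / A] with hM
  refine ⟨LinearMap.toContinuousLinearMap (Matrix.toLin' M), ?_, ?_⟩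
  · have h0 : HasFDerivAt (fun x : Fin 3 → ℝ => (![A / x 0, x 1, x 2 * x 0 ^ 2 / A] : Fin 3 → ℝ) 0)
        ((ContinuousLinearMap.proj 0).comp (LinearMap.toContinuousLinearMap (Matrix.toLin' M))) p := by
      simp only [Matrix.cons_val_zero]
      refine (inv_hasFDerivAt_constDiv A 0 p hp).congr_fderiv ?_
      ext v
      simp [hM, Matrix.toLin'_apply, dotProduct, Fin.sum_univ_three]
      ring
    have h1 : HasFDerivAt (fun x : Fin 3 → ℝ => (![A / x 0, x 1, x 2 * x 0 ^ 2 / A] : Fin 3 → ℝ) 1)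
        ((ContinuousLinearMap.proj 1).comp (LinearMap.toContinuousLinearMap (Matrix.toLin' M))) p := by
      simp only [Matrix.cons_val_one, Matrix.cons_val_zero]
      refine (hasFDerivAt_apply (𝕜 := ℝ) (1 : Fin 3) p).congr_fderiv ?_
      ext v
      simp [hM, Matrix.toLin'_apply, dotProduct, Fin.sum_univ_three]
    have h2 : HasFDerivAt (fun x : Fin 3 → ℝ => (![A / x 0, x 1, x 2 * x 0 ^ 2 / A] : Fin 3 → ℝ) 2)
        ((ContinuousLinearMap.proj 2).comp (LinearMap.toContinuousLinearMap (Matrix.toLin' M))) p := by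
      simp only [Matrix.cons_val_two, Matrix.tail_cons, Matrix.head_cons]
      refine (inv_hasFDerivAt_mulSqDiv A 0 p).congr_fderiv ?_
      ext v
      simp [hM, Matrix.toLin'_apply, dotProduct, Fin.sum_univ_three]
      ring
    refine hasFDerivAt_pi'' fun i => ?_
    fin_cases i
    exacts [h0, h1, h2]
  · have hdet : M.det = -1 := by
      rw [Matrix.det_fin_three]
      simp [hM]
      field_simp
    rw [LinearMap.det_toContinuousLinearMap, LinearMap.det_toLin', hdet]
    simp

/-- **Derivative and Jacobian of `S_A`.** At `p` with `y = p 1 ≠ 0` the map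
`S_A (x, y, z) = (x, A / y, z y² / A)` has the Fréchet derivative of matrix
`!![1, 0, 0; 0, -A / y², 0; 0, 2 z y / A, y² / A]`, whose determinant is `−1`. [folklore] -/
theorem inv_hasFDerivAt_det_snd {A : ℝ} (hA : A ≠ 0) {p : Fin 3 → ℝ} (hp : p 1 ≠ 0) :
    ∃ L : (Fin 3 → ℝ) →L[ℝ] (Fin 3 → ℝ),
      HasFDerivAt (fun x : Fin 3 → ℝ => (![x 0, A / x 1, x 2 * x 1 ^ 2 / A] : Fin 3 → ℝ)) L p ∧
        |L.det| = 1 := by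
  set M : Matrix (Fin 3) (Fin 3) ℝ :=
    !![1, 0, 0; 0, -A / p 1 ^ 2, 0; 0, 2 * p 2 * p 1 / A, p 1 ^ 2 / A] with hM
  refine ⟨LinearMap.toContinuousLinearMap (Matrix.toLin' M), ?_, ?_⟩
  · have h0 : HasFDerivAt (fun x : Fin 3 → ℝ => (![x 0, A / x 1, x 2 * x 1 ^ 2 / A] : Fin 3 → ℝ) 0)
        ((ContinuousLinearMap.proj 0).comp (LinearMap.toContinuousLinearMap (Matrix.toLin' M))) p := by
      simp only [Matrix.cons_val_zero]
      refine (hasFDerivAt_apply (𝕜 := ℝ) (0 : Fin 3) p).congr_fderiv ?_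
      ext v
      simp [hM, Matrix.toLin'_apply, dotProduct, Fin.sum_univ_three]
    have h1 : HasFDerivAt (fun x : Fin 3 → ℝ => (![x 0, A / x 1, x 2 * x 1 ^ 2 / A] : Fin 3 → ℝ) 1)
        ((ContinuousLinearMap.proj 1).comp (LinearMap.toContinuousLinearMap (Matrix.toLin' M))) p := by
      simp only [Matrix.cons_val_one, Matrix.cons_val_zero]
      refine (inv_hasFDerivAt_constDiv A 1 p hp).congr_fderiv ?_
      ext v
      simp [hM, Matrix.toLin'_apply, dotProduct, Fin.sum_univ_three]
      ring
    have h2 : HasFDerivAt (fun x : Fin 3 → ℝ => (![x 0, A / x 1, x 2 * x 1 ^ 2 / A] : Fin 3 → ℝ) 2)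
        ((ContinuousLinearMap.proj 2).comp (LinearMap.toContinuousLinearMap (Matrix.toLin' M))) p := by
      simp only [Matrix.cons_val_two, Matrix.tail_cons, Matrix.head_cons]
      refine (inv_hasFDerivAt_mulSqDiv A 1 p).congr_fderiv ?_
      ext v
      simp [hM, Matrix.toLin'_apply, dotProduct, Fin.sum_univ_three]
      ring
    refine hasFDerivAt_pi'' fun i => ?_
    fin_cases i
    exacts [h0, h1, h2]
  · have hdet : M.det = -1 := by
      rw [Matrix.det_fin_three]
      simp [hM]
      field_simp
    rw [LinearMap.det_toContinuousLinearMap, LinearMap.det_toLin', hdet]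
    simp

/-! ## Semialgebraicity and the involution property -/

/-- `R_A` is a `ℚ`-semialgebraic map on every `ℚ`-semialgebraic `σ ⊆ {x > 0}` for `A ≠ 0` real
algebraic: its coordinates are the algebraic constant `A` over the coordinate `x`, the coordinate
`y`, and the rational polynomial `z x²` over the algebraic constant `A`.
[Kontsevich–Zagier 2001, §1.1 ("rational" may be replaced by "algebraic")] [folklore] -/
theorem inv_isSemialgebraicMapOn_fst {A : ℝ} (hA : IsAlgebraic ℚ A) (hA0 : A ≠ 0)
    {s : Set (Fin 3 → ℝ)} (hs : IsSemialgebraic ℚ s) (hpos : s ⊆ {p | 0 < p 0}) :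
    IsSemialgebraicMapOn ℚ s
      (fun p : Fin 3 → ℝ => (![A / p 0, p 1, p 2 * p 0 ^ 2 / A] : Fin 3 → ℝ)) := by
  have hc : IsSemialgebraicFunOn ℚ s (fun _ => A) := isSemialgebraicFunOn_const_of_isAlgebraic hs hA
  have hX : ∀ k : Fin 3, IsSemialgebraicFunOn ℚ s (fun p : Fin 3 → ℝ => p k) := fun k =>
    (isSemialgebraicFunOn_aeval hs (X k)).congr fun p _ => by simp
  have h0 : IsSemialgebraicFunOn ℚ s
      (fun p : Fin 3 → ℝ => (![A / p 0, p 1, p 2 * p 0 ^ 2 / A] : Fin 3 → ℝ) 0) := by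
    simp only [Matrix.cons_val_zero]
    exact hc.div (hX 0) fun p hp => (hpos hp).ne'
  have h1 : IsSemialgebraicFunOn ℚ s
      (fun p : Fin 3 → ℝ => (![A / p 0, p 1, p 2 * p 0 ^ 2 / A] : Fin 3 → ℝ) 1) := by
    simp only [Matrix.cons_val_one, Matrix.cons_val_zero]
    exact hX 1
  have h2 : IsSemialgebraicFunOn ℚ s
      (fun p : Fin 3 → ℝ => (![A / p 0, p 1, p 2 * p 0 ^ 2 / A] : Fin 3 → ℝ) 2) := by
    simp only [Matrix.cons_val_two, Matrix.tail_cons, Matrix.head_cons]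
    exact ((isSemialgebraicFunOn_aeval hs (X 2 * X 0 ^ 2)).div hc fun _ _ => hA0).congr
      fun p _ => by simp
  refine IsSemialgebraicMapOn.of_forall hs fun k => ?_
  fin_cases k
  exacts [h0, h1, h2]

/-- `S_A` is a `ℚ`-semialgebraic map on every `ℚ`-semialgebraic `σ ⊆ {y > 0}` for `A ≠ 0` real
algebraic (coordinates `x`, `A / y`, `z y² / A`).
[Kontsevich–Zagier 2001, §1.1 ("rational" may be replaced by "algebraic")] [folklore] -/
theorem inv_isSemialgebraicMapOn_snd {A : ℝ} (hA : IsAlgebraic ℚ A) (hA0 : A ≠ 0)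
    {s : Set (Fin 3 → ℝ)} (hs : IsSemialgebraic ℚ s) (hpos : s ⊆ {p | 0 < p 1}) :
    IsSemialgebraicMapOn ℚ s
      (fun p : Fin 3 → ℝ => (![p 0, A / p 1, p 2 * p 1 ^ 2 / A] : Fin 3 → ℝ)) := by
  have hc : IsSemialgebraicFunOn ℚ s (fun _ => A) := isSemialgebraicFunOn_const_of_isAlgebraic hs hA
  have hX : ∀ k : Fin 3, IsSemialgebraicFunOn ℚ s (fun p : Fin 3 → ℝ => p k) := fun k =>
    (isSemialgebraicFunOn_aeval hs (X k)).congr fun p _ => by simp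
  have h0 : IsSemialgebraicFunOn ℚ s
      (fun p : Fin 3 → ℝ => (![p 0, A / p 1, p 2 * p 1 ^ 2 / A] : Fin 3 → ℝ) 0) := by
    simp only [Matrix.cons_val_zero]
    exact hX 0
  have h1 : IsSemialgebraicFunOn ℚ s
      (fun p : Fin 3 → ℝ => (![p 0, A / p 1, p 2 * p 1 ^ 2 / A] : Fin 3 → ℝ) 1) := by
    simp only [Matrix.cons_val_one, Matrix.cons_val_zero]
    exact hc.div (hX 1) fun p hp => (hpos hp).ne'
  have h2 : IsSemialgebraicFunOn ℚ s
      (fun p : Fin 3 → ℝ => (![p 0, A / p 1, p 2 * p 1 ^ 2 / A] : Fin 3 → ℝ) 2) := by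
    simp only [Matrix.cons_val_two, Matrix.tail_cons, Matrix.head_cons]
    exact ((isSemialgebraicFunOn_aeval hs (X 2 * X 1 ^ 2)).div hc fun _ _ => hA0).congr
      fun p _ => by simp
  refine IsSemialgebraicMapOn.of_forall hs fun k => ?_
  fin_cases k
  exacts [h0, h1, h2]

/-- `R_A` maps `{x > 0}` into itself (`A > 0`) and is an involution there:
`A / (A / x) = x` and `(z x² / A) · (A / x)² / A = z`. [folklore] -/
theorem inv_involutive_fst {A : ℝ} (hA : 0 < A) (p : Fin 3 → ℝ) (hp : 0 < p 0) :
    0 < (![A / p 0, p 1, p 2 * p 0 ^ 2 / A] : Fin 3 → ℝ) 0 ∧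
      (fun q : Fin 3 → ℝ => (![A / q 0, q 1, q 2 * q 0 ^ 2 / A] : Fin 3 → ℝ))
        (![A / p 0, p 1, p 2 * p 0 ^ 2 / A] : Fin 3 → ℝ) = p := by
  have hA0 : A ≠ 0 := hA.ne'
  have hp0 : p 0 ≠ 0 := hp.ne'
  refine ⟨by simpa using div_pos hA hp, ?_⟩
  funext i
  fin_cases i
  · simp only [Matrix.cons_val_zero, Fin.zero_eta, Fin.isValue]
    field_simp
  · simp
  · simp only [Matrix.cons_val_two, Matrix.tail_cons, Matrix.head_cons, Matrix.cons_val_zero,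
      Fin.reduceFinMk, Fin.isValue]
    field_simp

/-- `S_A` maps `{y > 0}` into itself (`A > 0`) and is an involution there. [folklore] -/
theorem inv_involutive_snd {A : ℝ} (hA : 0 < A) (p : Fin 3 → ℝ) (hp : 0 < p 1) :
    0 < (![p 0, A / p 1, p 2 * p 1 ^ 2 / A] : Fin 3 → ℝ) 1 ∧
      (fun q : Fin 3 → ℝ => (![q 0, A / q 1, q 2 * q 1 ^ 2 / A] : Fin 3 → ℝ))
        (![p 0, A / p 1, p 2 * p 1 ^ 2 / A] : Fin 3 → ℝ) = p := by
  have hA0 : A ≠ 0 := hA.ne'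
  have hp0 : p 1 ≠ 0 := hp.ne'
  refine ⟨by simpa using div_pos hA hp, ?_⟩
  funext i
  fin_cases i
  · simp
  · simp only [Matrix.cons_val_one, Matrix.cons_val_zero, Fin.mk_one, Fin.isValue]
    field_simp
  · simp only [Matrix.cons_val_two, Matrix.tail_cons, Matrix.head_cons, Matrix.cons_val_one,
      Matrix.cons_val_zero, Fin.reduceFinMk, Fin.isValue]
    field_simp

/-! ## The stub -/

/-- **Stub (the inversion moves)** of line `Sketch` of the crux `VolumeFormOffPlane`
(stmt-KontsevichZagierPeriods-14935). For `A > 0` real algebraic, the maps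
`(x, y, z) ↦ (A/x, y, z·x²/A)` and `(x, y, z) ↦ (x, A/y, z·y²/A)` are `ℚ`-semialgebraic `C¹`
involutions of `{x > 0}` resp. `{y > 0}` with `|det| = 1` preserving the slack product `z·xy`; so
integrand-`1` representations on a domain and on its image (membership transported along the map)
differ by ONE rule-(2) move: `[r] − [r'] ∈ KZ.changeOfVariablesRel ⊆ KZ.relations`.
[Kontsevich–Zagier 2001, §1.2 rule (2)] [folklore] -/
theorem stub_inversionMove : ((∀ (A : ℝ), 0 < A → IsAlgebraic ℚ A → ∀ (r r' : KZ.IntegralRep 3), r.domain ⊆ {p | 0 < p 0} → r'.domain ⊆ {p | 0 < p 0} → (∀ p : Fin 3 → ℝ, 0 < p 0 → (p ∈ r.domain ↔ (![A / p 0, p 1, p 2 * p 0 ^ 2 / A] : Fin 3 → ℝ) ∈ r'.domain)) → (∀ p ∈ r.domain, r.integrand p = 1) → (∀ p ∈ r'.domain, r'.integrand p = 1) → KZ.of r - KZ.of r' ∈ KZ.relations) ∧ (∀ (A : ℝ), 0 < A → IsAlgebraic ℚ A → ∀ (r r' : KZ.IntegralRep 3), r.domain ⊆ {p | 0 < p 1}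 → r'.domain ⊆ {p | 0 < p 1} → (∀ p : Fin 3 → ℝ, 0 < p 1 → (p ∈ r.domain ↔ (![p 0, A / p 1, p 2 * p 1 ^ 2 / A] : Fin 3 → ℝ) ∈ r'.domain)) → (∀ p ∈ r.domain, r.integrand p = 1) → (∀ p ∈ r'.domain, r'.integrand p = 1) → KZ.of r - KZ.of r' ∈ KZ.relations)) := by
  refine ⟨fun A hA hAalg r r' hr hr' htr h1 h1' => ?_, fun A hA hAalg r r' hr hr' htr h1 h1' => ?_⟩
  · exact inv_mem_relations_of_involutive (U := {p : Fin 3 → ℝ | 0 < p 0})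
      (Φ := fun p : Fin 3 → ℝ => (![A / p 0, p 1, p 2 * p 0 ^ 2 / A] : Fin 3 → ℝ))
      (fun s hsU hs => inv_isSemialgebraicMapOn_fst hAalg hA.ne' hs hsU)
      (fun p hp => inv_hasFDerivAt_det_fst hA.ne' (ne_of_gt hp))
      (fun p hp => (inv_involutive_fst hA p hp).1) (fun p hp => (inv_involutive_fst hA p hp).2)
      r r' hr hr' htr h1 h1'
  · exact inv_mem_relations_of_involutive (U := {p : Fin 3 → ℝ | 0 < p 1})
      (Φ := fun p : Fin 3 → ℝ => (![p 0, A / p 1, p 2 * p 1 ^ 2 / A] : Fin 3 → ℝ))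
      (fun s hsU hs => inv_isSemialgebraicMapOn_snd hAalg hA.ne' hs hsU)
      (fun p hp => inv_hasFDerivAt_det_snd hA.ne' (ne_of_gt hp))
      (fun p hp => (inv_involutive_snd hA p hp).1) (fun p hp => (inv_involutive_snd hA p hp).2)
      r r' hr hr' htr h1 h1'

end Summit.KontsevichZagierPeriods.SymplecticScissors.LogPolytope

end
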